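import Mathlib

/-!
# Crux `LacunarySymmetroid.MatrixDescartes` (stmt-ValiantsHypothesis-18050), line `Lift` —
# stub `stub_psdDominate`: Frobenius domination of a real symmetric matrix

For a real symmetric matrix `S` (size `m`) put `γ = 1 + ∑ᵢⱼ Sᵢⱼ²` (one plus the squared
Frobenius norm).  Then `γ • I - S` is positive semidefinite.  This is the splitting
`S = γ I - (γ I - S)` used by the PSD lift of a real symmetric lacunary pencil: every
coefficient becomes a difference of a nonnegative multiple of the identity and a positive
semidefinite matrix.

Proof: for a real vector `x`, Cauchy–Schwarz over the index set `Fin m × Fin m` gives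
`(xᵀ S x)² = (∑ᵢⱼ Sᵢⱼ xᵢ xⱼ)² ≤ (∑ᵢⱼ Sᵢⱼ²) (∑ᵢⱼ xᵢ² xⱼ²) = ‖S‖_F² ‖x‖⁴`, and
`‖S‖_F² ≤ (1 + ‖S‖_F²)²`, so `xᵀ S x ≤ (1 + ‖S‖_F²) ‖x‖²`, i.e. `xᵀ (γ I - S) x ≥ 0`;
symmetry of `γ I - S` is immediate from that of `S`.

References: Mathlib (`Matrix.PosSemidef.of_dotProduct_mulVec_nonneg`,
`Finset.sum_mul_sq_le_sq_mul_sq`); the estimate `|xᵀ S x| ≤ ‖S‖_F ‖x‖²` is folklore.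
-/

-- single-conjunct layout: Sub = Summit, duplicated namespace component intended
set_option linter.dupNamespace false

namespace Summit.ValiantsHypothesis.ValiantsHypothesis.Theorems.LacunarySymmetroidMatrixDescartes

open Matrix Finset
open scoped BigOperators

namespace PsdDominate

variable {m : ℕ}

/-- The quadratic form of a real matrix as a double sum: `xᵀ S x = ∑ᵢ ∑ⱼ Sᵢⱼ (xᵢ xⱼ)`.
[folklore] -/
theorem dotProduct_mulVec_eq_sum_sum (S : Matrix (Fin m) (Fin m) ℝ) (x : Fin m → ℝ) :
    x ⬝ᵥ S *ᵥ x = ∑ i, ∑ j, S i j * (x i * x j) := by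
  simp only [dotProduct, mulVec, Finset.mul_sum]
  refine Finset.sum_congr rfl fun i _ => Finset.sum_congr rfl fun j _ => ?_
  ring

/-- **Frobenius Cauchy–Schwarz**: `(xᵀ S x)² ≤ ‖S‖_F² · ‖x‖⁴`, i.e.
`(xᵀ S x)² ≤ (∑ᵢⱼ Sᵢⱼ²) (xᵀ x)²` (Cauchy–Schwarz over `Fin m × Fin m`). [folklore] -/
theorem dotProduct_mulVec_sq_le (S : Matrix (Fin m) (Fin m) ℝ) (x : Fin m → ℝ) :
    (x ⬝ᵥ S *ᵥ x) ^ 2 ≤ (∑ i, ∑ j, S i j ^ 2) * (x ⬝ᵥ x) ^ 2 := by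
  have hcs := Finset.sum_mul_sq_le_sq_mul_sq (Finset.univ : Finset (Fin m × Fin m))
    (fun p => S p.1 p.2) (fun p => x p.1 * x p.2)
  have h1 : ∑ p : Fin m × Fin m, S p.1 p.2 * (x p.1 * x p.2) = x ⬝ᵥ S *ᵥ x := by
    rw [dotProduct_mulVec_eq_sum_sum, Fintype.sum_prod_type]
  have h2 : ∑ p : Fin m × Fin m, S p.1 p.2 ^ 2 = ∑ i, ∑ j, S i j ^ 2 :=
    Fintype.sum_prod_type _
  have h3 : ∑ p : Fin m × Fin m, (x p.1 * x p.2) ^ 2 = (x ⬝ᵥ x) ^ 2 := by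
    rw [Fintype.sum_prod_type, sq (x ⬝ᵥ x), dotProduct, Finset.sum_mul_sum]
    refine Finset.sum_congr rfl fun i _ => Finset.sum_congr rfl fun j _ => ?_
    ring
  rw [h1, h2, h3] at hcs
  exact hcs

/-- **Frobenius domination of the quadratic form**: `xᵀ S x ≤ (1 + ‖S‖_F²) · xᵀ x`
(from `(xᵀ S x)² ≤ ‖S‖_F² (xᵀ x)² ≤ ((1 + ‖S‖_F²) xᵀ x)²` and `0 ≤ (1 + ‖S‖_F²) xᵀ x`).
[folklore] -/
theorem dotProduct_mulVec_le (S : Matrix (Fin m) (Fin m) ℝ) (x : Fin m → ℝ) :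
    x ⬝ᵥ S *ᵥ x ≤ (1 + ∑ i, ∑ j, S i j ^ 2) * (x ⬝ᵥ x) := by
  set F : ℝ := ∑ i, ∑ j, S i j ^ 2 with hF
  have hF0 : 0 ≤ F := Finset.sum_nonneg fun i _ => Finset.sum_nonneg fun j _ => sq_nonneg _
  have hn : 0 ≤ x ⬝ᵥ x := Finset.sum_nonneg fun i _ => mul_self_nonneg _
  have hsq : (x ⬝ᵥ S *ᵥ x) ^ 2 ≤ ((1 + F) * (x ⬝ᵥ x)) ^ 2 := by
    refine (dotProduct_mulVec_sq_le S x).trans ?_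
    rw [mul_pow]
    refine mul_le_mul_of_nonneg_right ?_ (sq_nonneg _)
    nlinarith [sq_nonneg F]
  exact (abs_le_of_sq_le_sq' hsq (mul_nonneg (by linarith) hn)).2

/-- `γ • I - S` is symmetric for symmetric `S`. [folklore] -/
theorem isSymm_smul_one_sub (c : ℝ) {S : Matrix (Fin m) (Fin m) ℝ} (hS : S.IsSymm) :
    (c • (1 : Matrix (Fin m) (Fin m) ℝ) - S).IsSymm :=
  (Matrix.isSymm_one.smul c).sub hS

end PsdDominate

open PsdDominate in
/-- **PSD domination** (stub `stub_psdDominate` of line `Lift`): for a real symmetric `S`,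
`(1 + ∑ᵢⱼ Sᵢⱼ²) • I - S` is positive semidefinite — the Frobenius norm bounds the quadratic
form, `xᵀ S x ≤ ‖S‖_F ‖x‖² ≤ (1 + ‖S‖_F²) ‖x‖²`. [folklore] -/
theorem stub_psdDominate (m : ℕ) (S : Matrix (Fin m) (Fin m) ℝ) (hS : S.IsSymm) :
    ((1 + ∑ i, ∑ j, S i j ^ 2) • (1 : Matrix (Fin m) (Fin m) ℝ) - S).PosSemidef := by
  refine Matrix.PosSemidef.of_dotProduct_mulVec_nonneg
    (Matrix.isHermitian_iff_isSymm.2 (isSymm_smul_one_sub _ hS)) fun x => ?_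
  rw [star_trivial, Matrix.sub_mulVec, Matrix.smul_mulVec, Matrix.one_mulVec, dotProduct_sub,
    dotProduct_smul, smul_eq_mul, sub_nonneg]
  exact dotProduct_mulVec_le S x

end Summit.ValiantsHypothesis.ValiantsHypothesis.Theorems.LacunarySymmetroidMatrixDescartes
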